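import Mathlib.Analysis.SpecialFunctions.Trigonometric.EulerSineProd
import Mathlib.Analysis.SpecialFunctions.Trigonometric.Series
import Mathlib.Analysis.Analytic.OfScalars
import Mathlib.Analysis.Analytic.Uniqueness
import Mathlib.Analysis.Normed.Group.Tannery
import Mathlib.Analysis.PSeries
import Mathlib.NumberTheory.ZetaValues
import Literature.NumberTheory.Transcendental.MultipleZetaStuffle
import Literature.NumberTheory.Transcendental.MultipleZetaValuesBridgeProofs
import Literature.NumberTheory.Transcendental.MultipleZetaValuesProofs
import HarnessLib

/-!
# Multiple zeta values — `ζ(2, 2, …, 2) = π²ⁿ/(2n+1)!` (Hoffman 1992, Cor. 2.3; Brown 2012, (3.7))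

Sibling proof file of `Literature.NumberTheory.Transcendental.MultipleZetaValues` (D-0014), in the
cone of the named fact `hoffmanSpan_eq_mzvSpace` (Brown 2012, Theorem 1.1: the Hoffman elements
`ζ(s)`, `s ∈ {2,3}^×`, span all multiple zeta values). It proves, for EVERY `n`, the classical
evaluation of the simplest Hoffman element

* `multipleZeta_replicate_two` : `ζ({2}ⁿ) = ζ(2, …, 2) = π²ⁿ / (2n+1)!`

— Hoffman 1992, Corollary 2.3 (p. 278, proving a conjecture of C. Moen); it is formula (3.7) of
Brown 2012, §3.3 ("the well-known formula"), where it fixes the rational coefficient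
`ζᵐ({2}ⁿ) ∈ ℚ ζᵐ(2)ⁿ` of Lemma 3.4 and enters the `2`-adic argument through Zagier's theorem;
Chmutov–Duzhin–Mostovoy 2012, §10.2.6, eq. (10.17) — and draws the first consequences of Brown's
theorem that hold in ALL weights:

* `pi_pow_two_mul_mem_hoffmanSpan` : `π²ⁿ ∈ hoffmanSpan (2n)`;
* `multipleZeta_two_mul_eq` : `ζ(2k) = (-1)^{k+1} 2^{2k-1} B_{2k} π^{2k} / (2k)!` (Euler; Mathlib's
  `hasSum_zeta_nat` transported to `multipleZeta`), whence
* `multipleZeta_even_mem_hoffmanSpan` : `ζ(2k) ∈ hoffmanSpan (2k)` for every `k ≥ 1`, and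
  `multipleZeta_replicate_two_mem_span_multipleZeta_two_pow` : `ζ({2}ⁿ) ∈ ℚ ζ(2)ⁿ`
  (the real shadow of Brown's Lemma 3.4).

## The proof (Euler's product; e.g. Zagier 1994 §9, Chmutov–Duzhin–Mostovoy §10.2.6)

We do not follow Hoffman's symmetric-function/Bernoulli-number proof of Cor. 2.3 but the classical
generating-function argument, which Mathlib makes available through Euler's product formula
`Real.tendsto_euler_sin_prod : π x ∏_{j<N} (1 - x²/(j+1)²) → sin (π x)`:

1. (`MZV.prod_range_one_add_div_sq`) the finite identity
   `∏_{j<N} (1 + t/(j+1)²) = ∑_{n ≤ N} Z_{N+1}({2}ⁿ) tⁿ`, where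
   `Z_N(s) = ∑_{N > n₁ > ⋯ > n_k ≥ 1} ∏ nᵢ^{-sᵢ}` is the truncated multiple zeta sum `MZV.mzvTrunc`
   of `MultipleZetaStuffle.lean`; by induction on `N` from Hoffman's recursion
   `Z_{N+1}(2 :: s) = Z_N(2 :: s) + N^{-2} Z_N(s)` (`MZV.mzvTrunc_cons_succ`) — the coefficients
   of `∏ (1 + t xⱼ)` are the elementary symmetric functions of the `xⱼ = 1/j²`;
2. (`MZV.mzvTrunc_replicate_two_le`) the crude bound `Z_N({2}ⁿ) ≤ 2ⁿ` (from `∑ 1/j² ≤ 2`), so that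
   Tannery's theorem (`tendsto_tsum_of_dominated_convergence`) and `Z_N(s) → ζ(s)`
   (`MZV.tendsto_mzvTrunc`) give `∏_{j<N} (1 - x²/(j+1)²) → ∑ₙ (-1)ⁿ ζ({2}ⁿ) x²ⁿ` for `2x² < 1`
   (`hasSum_multipleZeta_replicate_two_sin`): `sin (π x) = ∑ₙ (-1)ⁿ π ζ({2}ⁿ) x^{2n+1}`;
3. comparison with `sin (π x) = ∑ₙ (-1)ⁿ π^{2n+1} x^{2n+1}/(2n+1)!` (`Real.hasSum_sin`) and
   uniqueness of power-series coefficients (`HasFPowerSeriesAt.eq_formalMultilinearSeries`, applied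
   to the two odd series packaged as `FormalMultilinearSeries.ofScalars`;
   `hasFPowerSeriesOnBall_of_odd_hasSum`, `eq_of_odd_hasSum`).

No new definitions and no named facts are introduced (pure proofs, D-0026).

## References

* M. E. Hoffman, *Multiple harmonic series*, Pacific J. Math. **152** (1992), 275–290,
  Corollary 2.3 (p. 278). [Hoffman1992]
* F. Brown, *Mixed Tate motives over ℤ*, Ann. of Math. **175** (2012), 949–976, §3.3 eq. (3.7) and
  Lemma 3.4 (arXiv:1102.1312, p. 9). [Brown2012]
* S. Chmutov, S. Duzhin, J. Mostovoy, *Introduction to Vassiliev Knot Invariants*, CUP (2012),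
  §10.2.6 eq. (10.17). [ChmutovDuzhinMostovoy2012]
* D. Zagier, *Values of zeta functions and their applications*, ECM Paris 1992, Progr. Math. 120
  (1994), 497–512, §9. [ZagierECM1994]
-/

noncomputable section

open scoped BigOperators
open scoped Nat
open Filter Topology Real

namespace Literature.NumberTheory.Transcendental

namespace MZV

/-! ### The index `{2}ⁿ` -/

/-- `{2}ⁿ = (2, …, 2)` is a Hoffman index. [folklore] -/
theorem isHoffman_replicate_two (n : ℕ) : IsHoffman (List.replicate n 2) :=
  fun _ hi => Or.inl (List.eq_of_mem_replicate hi)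

/-- `{2}ⁿ` is admissible. [folklore] -/
theorem isAdmissible_replicate_two (n : ℕ) : IsAdmissible (List.replicate n 2) :=
  (isHoffman_replicate_two n).isAdmissible

/-- `{2}ⁿ` has weight `2n`. [folklore] -/
@[simp] theorem weight_replicate_two (n : ℕ) : weight (List.replicate n 2) = 2 * n := by
  simp [weight, List.sum_replicate, mul_comm]

/-! ### Truncated sums: recursion in `N`, vanishing, and a crude bound -/

/-- Truncated multiple zeta sums are nonnegative. [folklore] -/
theorem mzvTrunc_nonneg (s : List ℕ) (N : ℕ) : 0 ≤ mzvTrunc s N :=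
  Finset.sum_nonneg fun n _ => mzvTerm_nonneg s n

/-- Hoffman's recursion in the truncation parameter: passing from `N` to `N + 1` adds the terms
with leading entry `n₁ = N`, i.e. `Z_{N+1}(a :: s) = Z_N(a :: s) + N^{-a} Z_N(s)` (`N ≥ 1`).
[cite: Hoffman1997, §3 (∗)] -/
theorem mzvTrunc_cons_succ (a : ℕ) (s : List ℕ) {N : ℕ} (hN : 1 ≤ N) :
    mzvTrunc (a :: s) (N + 1) = mzvTrunc (a :: s) N + ((N : ℝ) ^ a)⁻¹ * mzvTrunc s N := by
  rw [mzvTrunc_cons, mzvTrunc_cons, Finset.sum_Ico_succ_top hN]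

/-- A nested sum over `N > n₁ > ⋯ > n_k ≥ 1` with `k ≥ N` is empty:
`Z_N(a :: s) = 0` whenever `N ≤ ℓ(s) + 1`. [folklore] -/
theorem mzvTrunc_cons_eq_zero_of_le :
    ∀ (a : ℕ) (s : List ℕ) {N : ℕ}, N ≤ s.length + 1 → mzvTrunc (a :: s) N = 0
  | a, [], N, hN => by
      rw [mzvTrunc_cons]
      refine Finset.sum_eq_zero fun m hm => ?_
      rw [Finset.mem_Ico] at hm
      simp only [List.length_nil] at hN
      omega
  | a, b :: s, N, hN => by
      rw [mzvTrunc_cons]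
      refine Finset.sum_eq_zero fun m hm => ?_
      rw [Finset.mem_Ico] at hm
      simp only [List.length_cons] at hN
      rw [mzvTrunc_cons_eq_zero_of_le b s (N := m) (by omega), mul_zero]

/-- `Z_N({2}ⁿ) = 0` for `1 ≤ n` and `N ≤ n`. [folklore] -/
theorem mzvTrunc_replicate_two_eq_zero {n N : ℕ} (hn : n ≠ 0) (h : N ≤ n) :
    mzvTrunc (List.replicate n 2) N = 0 := by
  obtain ⟨k, rfl⟩ := Nat.exists_eq_succ_of_ne_zero hn
  rw [List.replicate_succ]
  exact mzvTrunc_cons_eq_zero_of_le 2 _ (by simpa using h)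

/-- `∑_{1 ≤ m < N} 1/m² ≤ 2`. [folklore] -/
theorem sum_Ico_inv_sq_le_two (N : ℕ) : ∑ m ∈ Finset.Ico 1 N, ((m : ℝ) ^ 2)⁻¹ ≤ 2 := by
  have h := sum_Ioo_inv_sq_le (α := ℝ) 0 N
  rw [Nat.cast_zero, zero_add, div_one] at h
  have hI : Finset.Ico 1 N = Finset.Ioo 0 N := by
    ext m
    simp only [Finset.mem_Ico, Finset.mem_Ioo]
    omega
  rwa [hI]

/-- The crude bound `Z_N({2}ⁿ) ≤ 2ⁿ` (each new leading variable contributes `∑ 1/m² ≤ 2`).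
[folklore] -/
theorem mzvTrunc_replicate_two_le (n : ℕ) : ∀ N, mzvTrunc (List.replicate n 2) N ≤ 2 ^ n := by
  induction n with
  | zero => intro N; simp
  | succ n ih =>
    intro N
    rw [List.replicate_succ, mzvTrunc_cons]
    calc ∑ m ∈ Finset.Ico 1 N, ((m : ℝ) ^ 2)⁻¹ * mzvTrunc (List.replicate n 2) m
        ≤ ∑ m ∈ Finset.Ico 1 N, ((m : ℝ) ^ 2)⁻¹ * 2 ^ n :=
          Finset.sum_le_sum fun m _ => mul_le_mul_of_nonneg_left (ih m) (by positivity)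
      _ = (∑ m ∈ Finset.Ico 1 N, ((m : ℝ) ^ 2)⁻¹) * 2 ^ n := (Finset.sum_mul _ _ _).symm
      _ ≤ 2 * 2 ^ n := mul_le_mul_of_nonneg_right (sum_Ico_inv_sq_le_two N) (by positivity)
      _ = 2 ^ (n + 1) := by ring

/-! ### Euler's finite product as a polynomial with truncated-MZV coefficients -/

/-- One induction step of `MZV.prod_range_one_add_div_sq`: with
`F_N(t) = ∑_{n ≤ N} Z_{N+1}({2}ⁿ) tⁿ`, `F_{N+1}(t) = F_N(t) · (1 + t/(N+1)²)`. [folklore] -/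
theorem sum_mzvTrunc_replicate_two_succ (t : ℝ) (N : ℕ) :
    ∑ n ∈ Finset.range (N + 1 + 1), mzvTrunc (List.replicate n 2) (N + 1 + 1) * t ^ n =
      (∑ n ∈ Finset.range (N + 1), mzvTrunc (List.replicate n 2) (N + 1) * t ^ n) *
        (1 + t / ((N : ℝ) + 1) ^ 2) := by
  -- Hoffman's recursion for the coefficients, and vanishing of the top one.
  have hc : ∀ n, mzvTrunc (List.replicate (n + 1) 2) (N + 1 + 1) =
      mzvTrunc (List.replicate (n + 1) 2) (N + 1) +
        (((N : ℝ) + 1) ^ 2)⁻¹ * mzvTrunc (List.replicate n 2) (N + 1) := by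
    intro n
    have h := mzvTrunc_cons_succ 2 (List.replicate n 2) (N := N + 1) (Nat.succ_pos N)
    rw [Nat.cast_succ] at h
    simpa only [List.replicate_succ] using h
  have hv : mzvTrunc (List.replicate (N + 1) 2) (N + 1) = 0 :=
    mzvTrunc_replicate_two_eq_zero (Nat.succ_ne_zero N) le_rfl
  set A := ∑ n ∈ Finset.range N, mzvTrunc (List.replicate (n + 1) 2) (N + 1) * t ^ (n + 1)
    with hA
  set B := ∑ n ∈ Finset.range (N + 1), mzvTrunc (List.replicate n 2) (N + 1) * t ^ n with hB
  have hBA : B = A + 1 := by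
    rw [hB, Finset.sum_range_succ']
    simp [hA]
  have hL : ∑ n ∈ Finset.range (N + 1 + 1), mzvTrunc (List.replicate n 2) (N + 1 + 1) * t ^ n =
      A + (((N : ℝ) + 1) ^ 2)⁻¹ * t * B + 1 := by
    rw [Finset.sum_range_succ']
    simp only [hc, List.replicate_zero, mzvTrunc_nil, pow_zero, mul_one, add_mul,
      Finset.sum_add_distrib]
    rw [Finset.sum_range_succ, hv, zero_mul, add_zero, hB, Finset.mul_sum]
    congr 1
    congr 1
    refine Finset.sum_congr rfl fun n _ => ?_
    ring
  rw [hL, hBA]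
  have hN : ((N : ℝ) + 1) ^ 2 ≠ 0 := by positivity
  field_simp
  ring

/-- **Euler's finite product expanded**: `∏_{j<N} (1 + t/(j+1)²) = ∑_{n ≤ N} Z_{N+1}({2}ⁿ) tⁿ` — the
coefficient of `tⁿ` in `∏_{m ≤ N} (1 + t/m²)` is the elementary symmetric function
`e_n(1/1², …, 1/N²) = ∑_{N ≥ n₁ > ⋯ > nₙ ≥ 1} ∏ nᵢ^{-2} = Z_{N+1}({2}ⁿ)`. [folklore] -/
theorem prod_range_one_add_div_sq (t : ℝ) : ∀ N : ℕ,
    ∏ j ∈ Finset.range N, (1 + t / ((j : ℝ) + 1) ^ 2) =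
      ∑ n ∈ Finset.range (N + 1), mzvTrunc (List.replicate n 2) (N + 1) * t ^ n
  | 0 => by simp
  | N + 1 => by
      rw [Finset.prod_range_succ, prod_range_one_add_div_sq t N]
      exact (sum_mzvTrunc_replicate_two_succ t N).symm

end MZV

open MZV

/-! ### `ζ({2}ⁿ)`: nonnegativity, the bound `≤ 2ⁿ`, and Euler's product in the limit -/

/-- `0 ≤ ζ({2}ⁿ)`. [folklore] -/
theorem multipleZeta_replicate_two_nonneg (n : ℕ) : 0 ≤ multipleZeta (List.replicate n 2) :=
  ge_of_tendsto' (tendsto_mzvTrunc (isAdmissible_replicate_two n)) fun N => mzvTrunc_nonneg _ N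

/-- `ζ({2}ⁿ) ≤ 2ⁿ`. [folklore] -/
theorem multipleZeta_replicate_two_le (n : ℕ) : multipleZeta (List.replicate n 2) ≤ 2 ^ n :=
  le_of_tendsto' (tendsto_mzvTrunc (isAdmissible_replicate_two n)) (mzvTrunc_replicate_two_le n)

/-- `‖(-x²)ⁿ‖ = (x²)ⁿ`. [folklore] -/
theorem norm_neg_sq_pow (x : ℝ) (n : ℕ) : ‖(-x ^ 2) ^ n‖ = (x ^ 2) ^ n := by
  rw [norm_pow, norm_neg, norm_pow, Real.norm_eq_abs, sq_abs]

/-- **Euler's product in the limit** (Tannery's theorem): for `2x² < 1`,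
`∏_{j<N} (1 - x²/(j+1)²) → ∑ₙ ζ({2}ⁿ) (-x²)ⁿ` as `N → ∞`. [folklore] -/
theorem tendsto_prod_range_one_sub_sq_div {x : ℝ} (hx : 2 * x ^ 2 < 1) :
    Tendsto (fun N : ℕ => ∏ j ∈ Finset.range N, (1 - x ^ 2 / ((j : ℝ) + 1) ^ 2)) atTop
      (𝓝 (∑' n, multipleZeta (List.replicate n 2) * (-x ^ 2) ^ n)) := by
  have h2x : 0 ≤ 2 * x ^ 2 := by positivity
  have hf : ∀ N n : ℕ,
      ‖mzvTrunc (List.replicate n 2) (N + 1) * (-x ^ 2) ^ n‖ ≤ (2 * x ^ 2) ^ n := by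
    intro N n
    rw [norm_mul, norm_neg_sq_pow, Real.norm_of_nonneg (mzvTrunc_nonneg _ _), mul_pow]
    exact mul_le_mul_of_nonneg_right (mzvTrunc_replicate_two_le n (N + 1)) (by positivity)
  have hlim : ∀ n : ℕ, Tendsto (fun N : ℕ => mzvTrunc (List.replicate n 2) (N + 1) * (-x ^ 2) ^ n)
      atTop (𝓝 (multipleZeta (List.replicate n 2) * (-x ^ 2) ^ n)) := fun n =>
    ((tendsto_mzvTrunc (isAdmissible_replicate_two n)).comp (tendsto_add_atTop_nat 1)).mul_const _
  have hT := tendsto_tsum_of_dominated_convergence (summable_geometric_of_lt_one h2x hx) hlim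
    (Eventually.of_forall hf)
  refine hT.congr fun N => ?_
  rw [tsum_eq_sum (s := Finset.range (N + 1)), ← prod_range_one_add_div_sq (-x ^ 2) N]
  · exact Finset.prod_congr rfl fun j _ => by ring
  · intro n hn
    rw [Finset.mem_range, not_lt] at hn
    rw [mzvTrunc_replicate_two_eq_zero (by omega) hn, zero_mul]

/-- **`sin (π x) = π x ∑ₙ (-1)ⁿ ζ({2}ⁿ) x²ⁿ`** for `2x² < 1`: Euler's product formula
`sin (π x) = π x ∏ (1 - x²/m²)` (`Real.tendsto_euler_sin_prod`) with the product expanded in the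
elementary symmetric functions `ζ({2}ⁿ)` of the `1/m²`.
[cite: ChmutovDuzhinMostovoy2012, §10.2.6 eq. (10.17)] -/
theorem hasSum_sin_pi_mul_multipleZeta_replicate_two {x : ℝ} (hx : 2 * x ^ 2 < 1) :
    HasSum (fun n : ℕ => (-1) ^ n * π * multipleZeta (List.replicate n 2) * x ^ (2 * n + 1))
      (Real.sin (π * x)) := by
  have h2x : 0 ≤ 2 * x ^ 2 := by positivity
  have hS : Summable fun n : ℕ => multipleZeta (List.replicate n 2) * (-x ^ 2) ^ n := by
    refine Summable.of_norm_bounded (summable_geometric_of_lt_one h2x hx) fun n => ?_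
    rw [norm_mul, norm_neg_sq_pow, Real.norm_of_nonneg (multipleZeta_replicate_two_nonneg n),
      mul_pow]
    exact mul_le_mul_of_nonneg_right (multipleZeta_replicate_two_le n) (by positivity)
  have hP : Tendsto (fun N : ℕ => π * x * ∏ j ∈ Finset.range N, (1 - x ^ 2 / ((j : ℝ) + 1) ^ 2))
      atTop (𝓝 (π * x * ∑' n, multipleZeta (List.replicate n 2) * (-x ^ 2) ^ n)) :=
    (tendsto_prod_range_one_sub_sq_div hx).const_mul _
  rw [tendsto_nhds_unique (Real.tendsto_euler_sin_prod x) hP, ← tsum_mul_left]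
  have hfun : (fun n : ℕ => (-1) ^ n * π * multipleZeta (List.replicate n 2) * x ^ (2 * n + 1)) =
      fun n : ℕ => π * x * (multipleZeta (List.replicate n 2) * (-x ^ 2) ^ n) := by
    funext n
    ring
  rw [hfun]
  exact (hS.mul_left (π * x)).hasSum

/-! ### Uniqueness of the coefficients of an odd power series -/

/-- An odd real power series `∑ₖ cₖ y^{2k+1}` with `|cₖ| r^{2k+1}` bounded, summing to `f y` for
`|y| < r`, is a power-series expansion of `f` on the ball of radius `r` (packaged as
`FormalMultilinearSeries.ofScalars` with vanishing even coefficients). [folklore] -/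
theorem hasFPowerSeriesOnBall_of_odd_hasSum {c : ℕ → ℝ} {f : ℝ → ℝ} {r : NNReal} (hr : 0 < r)
    {C : ℝ} (hb : ∀ k, |c k| * (r : ℝ) ^ (2 * k + 1) ≤ C)
    (hf : ∀ y : ℝ, |y| < r → HasSum (fun k => c k * y ^ (2 * k + 1)) (f y)) :
    HasFPowerSeriesOnBall f
      (FormalMultilinearSeries.ofScalars ℝ fun m => if Even m then 0 else c (m / 2)) 0 r where
  r_le := by
    refine FormalMultilinearSeries.le_radius_of_bound _ (max C 0) fun m => ?_
    rw [FormalMultilinearSeries.ofScalars_norm]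
    rcases Nat.even_or_odd m with hm | ⟨k, rfl⟩
    · simp [hm]
    · have hk : ¬ Even (2 * k + 1) := Nat.not_even_iff_odd.mpr ⟨k, rfl⟩
      have hd : (2 * k + 1) / 2 = k := by omega
      simp only [hk, if_false, hd, Real.norm_eq_abs]
      exact (hb k).trans (le_max_left _ _)
  r_pos := ENNReal.coe_pos.mpr hr
  hasSum := by
    intro y hy
    rw [Metric.eball_coe, Metric.mem_ball, dist_zero_right, Real.norm_eq_abs] at hy
    simp only [FormalMultilinearSeries.ofScalars_apply_eq, smul_eq_mul, zero_add]
    have he : HasSum (fun k => (if Even (2 * k) then 0 else c (2 * k / 2)) * y ^ (2 * k)) 0 := by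
      have h0 : (fun k => (if Even (2 * k) then 0 else c (2 * k / 2)) * y ^ (2 * k)) =
          fun _ => 0 := by
        funext k
        simp
      rw [h0]
      exact hasSum_zero
    have ho : HasSum
        (fun k => (if Even (2 * k + 1) then 0 else c ((2 * k + 1) / 2)) * y ^ (2 * k + 1))
        (f y) := by
      have h1 : (fun k => (if Even (2 * k + 1) then 0 else c ((2 * k + 1) / 2)) * y ^ (2 * k + 1))
          = fun k => c k * y ^ (2 * k + 1) := by
        funext k
        have hk : ¬ Even (2 * k + 1) := Nat.not_even_iff_odd.mpr ⟨k, rfl⟩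
        have hd : (2 * k + 1) / 2 = k := by omega
        simp [hk, hd]
      rw [h1]
      exact hf y hy
    simpa only [zero_add] using
      HasSum.even_add_odd (f := fun m => (if Even m then 0 else c (m / 2)) * y ^ m) he ho

/-- **Uniqueness of coefficients** for odd real power series: if `∑ₖ cₖ y^{2k+1}` and
`∑ₖ c'ₖ y^{2k+1}` both sum to `f y` for `|y| < r` (with `|cₖ| r^{2k+1}`, `|c'ₖ| r^{2k+1}`
bounded), then `c = c'` (`HasFPowerSeriesAt.eq_formalMultilinearSeries`). [folklore] -/
theorem eq_of_odd_hasSum {c c' : ℕ → ℝ} {f : ℝ → ℝ} {r : NNReal} (hr : 0 < r) {C : ℝ}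
    (hb : ∀ k, |c k| * (r : ℝ) ^ (2 * k + 1) ≤ C) (hb' : ∀ k, |c' k| * (r : ℝ) ^ (2 * k + 1) ≤ C)
    (hf : ∀ y : ℝ, |y| < r → HasSum (fun k => c k * y ^ (2 * k + 1)) (f y))
    (hf' : ∀ y : ℝ, |y| < r → HasSum (fun k => c' k * y ^ (2 * k + 1)) (f y)) : c = c' := by
  have h := (hasFPowerSeriesOnBall_of_odd_hasSum hr hb hf).hasFPowerSeriesAt.eq_formalMultilinearSeries
    (hasFPowerSeriesOnBall_of_odd_hasSum hr hb' hf').hasFPowerSeriesAt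
  rw [FormalMultilinearSeries.ofScalars_series_eq_iff] at h
  funext k
  have hk := congrFun h (2 * k + 1)
  have hodd : ¬ Even (2 * k + 1) := Nat.not_even_iff_odd.mpr ⟨k, rfl⟩
  have hd : (2 * k + 1) / 2 = k := by omega
  simpa [hodd, hd] using hk

/-! ### The evaluation `ζ({2}ⁿ) = π²ⁿ/(2n+1)!` and its consequences for the Hoffman span -/

/-- **Hoffman 1992, Corollary 2.3; Brown 2012, (3.7)** — for every `n`,
`ζ(2, 2, …, 2) = ζ({2}ⁿ) = π²ⁿ / (2n+1)!` (`n` twos; conjectured by C. Moen, proved by Hoffman;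
"the well-known formula" (3.7) of Brown's §3.3; Chmutov–Duzhin–Mostovoy (10.17)). Proof: compare
the coefficients of `x^{2n+1}` in `sin (π x) = π x ∑ₙ (-1)ⁿ ζ({2}ⁿ) x²ⁿ` (Euler's product,
`hasSum_sin_pi_mul_multipleZeta_replicate_two`) and in the sine series (`Real.hasSum_sin`).
[cite: Hoffman1992, Corollary 2.3] -/
theorem multipleZeta_replicate_two (n : ℕ) :
    multipleZeta (List.replicate n 2) = π ^ (2 * n) / (2 * n + 1)! := by
  have hr : (0 : NNReal) < 1 / 4 := by norm_num
  have hrr : ((1 / 4 : NNReal) : ℝ) = 1 / 4 := by norm_num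
  -- the coefficient bounds at `r = 1/4`
  have hb : ∀ k : ℕ, |(-1 : ℝ) ^ k * π * multipleZeta (List.replicate k 2)| *
      ((1 / 4 : NNReal) : ℝ) ^ (2 * k + 1) ≤ 4 := by
    intro k
    rw [hrr, abs_mul, abs_mul, abs_pow, abs_neg, abs_one, one_pow, one_mul,
      abs_of_pos Real.pi_pos, abs_of_nonneg (multipleZeta_replicate_two_nonneg k)]
    have h1 : multipleZeta (List.replicate k 2) * (1 / 4 : ℝ) ^ (2 * k + 1) ≤ 1 :=
      calc multipleZeta (List.replicate k 2) * (1 / 4 : ℝ) ^ (2 * k + 1)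
          ≤ 2 ^ k * (1 / 4 : ℝ) ^ (2 * k + 1) :=
            mul_le_mul_of_nonneg_right (multipleZeta_replicate_two_le k) (by positivity)
        _ = (1 / 2) ^ (3 * k + 2) := by
            rw [show (1 / 4 : ℝ) = (1 / 2) ^ 2 by norm_num, ← pow_mul,
              show (2 : ℝ) ^ k = ((1 / 2) ^ k)⁻¹ by rw [← inv_pow]; norm_num]
            field_simp
            ring
        _ ≤ 1 := pow_le_one₀ (by norm_num) (by norm_num)
    calc π * multipleZeta (List.replicate k 2) * (1 / 4 : ℝ) ^ (2 * k + 1)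
        = π * (multipleZeta (List.replicate k 2) * (1 / 4 : ℝ) ^ (2 * k + 1)) := mul_assoc _ _ _
      _ ≤ π * 1 := mul_le_mul_of_nonneg_left h1 Real.pi_pos.le
      _ ≤ 4 := by rw [mul_one]; exact Real.pi_le_four
  have hb' : ∀ k : ℕ, |(-1 : ℝ) ^ k * π ^ (2 * k + 1) / (2 * k + 1)!| *
      ((1 / 4 : NNReal) : ℝ) ^ (2 * k + 1) ≤ 4 := by
    intro k
    rw [hrr, abs_div, abs_mul, abs_pow, abs_pow, abs_neg, abs_one, one_pow, one_mul,
      abs_of_pos Real.pi_pos, Nat.abs_cast, div_mul_eq_mul_div, ← mul_pow]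
    have hπ4 : π * (1 / 4 : ℝ) ≤ 1 := by
      have := Real.pi_le_four
      linarith
    calc (π * (1 / 4 : ℝ)) ^ (2 * k + 1) / ((2 * k + 1)! : ℝ) ≤ 1 / 1 := by
          refine div_le_div₀ zero_le_one (pow_le_one₀ (by positivity) hπ4) one_pos ?_
          exact_mod_cast Nat.succ_le_of_lt (Nat.factorial_pos _)
      _ ≤ 4 := by norm_num
  -- the two expansions of `sin (π y)` on `|y| < 1/4`
  have hf : ∀ y : ℝ, |y| < ((1 / 4 : NNReal) : ℝ) → HasSum
      (fun k : ℕ => (-1 : ℝ) ^ k * π * multipleZeta (List.replicate k 2) * y ^ (2 * k + 1))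
      (Real.sin (π * y)) := by
    intro y hy
    rw [hrr] at hy
    refine hasSum_sin_pi_mul_multipleZeta_replicate_two ?_
    have h := abs_lt.mp hy
    nlinarith [h.1, h.2]
  have hf' : ∀ y : ℝ, |y| < ((1 / 4 : NNReal) : ℝ) → HasSum
      (fun k : ℕ => (-1 : ℝ) ^ k * π ^ (2 * k + 1) / (2 * k + 1)! * y ^ (2 * k + 1))
      (Real.sin (π * y)) := by
    intro y _
    have h := Real.hasSum_sin (π * y)
    have hfun : (fun n : ℕ => (-1 : ℝ) ^ n * (π * y) ^ (2 * n + 1) / ↑(2 * n + 1)!) =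
        fun k : ℕ => (-1 : ℝ) ^ k * π ^ (2 * k + 1) / (2 * k + 1)! * y ^ (2 * k + 1) := by
      funext k
      rw [mul_pow]
      ring
    rwa [hfun] at h
  have key := congrFun (eq_of_odd_hasSum hr hb hb' hf hf') n
  have h1 : (-1 : ℝ) ^ n * π ≠ 0 := mul_ne_zero (pow_ne_zero _ (by norm_num)) Real.pi_ne_zero
  refine mul_left_cancel₀ h1 ?_
  rw [key]
  ring

/-- `ζ({2}ⁿ)` is a Hoffman element of weight `2n`. [folklore] -/
theorem multipleZeta_replicate_two_mem_hoffmanSpan (n : ℕ) :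
    multipleZeta (List.replicate n 2) ∈ hoffmanSpan (2 * n) :=
  Submodule.subset_span ⟨_, isHoffman_replicate_two n, weight_replicate_two n, rfl⟩

/-- **`π²ⁿ ∈ hoffmanSpan (2n)`** for every `n`: `π²ⁿ = (2n+1)! · ζ({2}ⁿ)` — the level-zero part of
Brown's theorem `hoffmanSpan_eq_mzvSpace`, valid in all weights (Brown 2012, Lemma 3.4 and (3.7)).
[cite: Brown2012, §3.3 Lemma 3.4 and eq. (3.7)] -/
theorem pi_pow_two_mul_mem_hoffmanSpan (n : ℕ) : π ^ (2 * n) ∈ hoffmanSpan (2 * n) := by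
  have hf : ((2 * n + 1)! : ℝ) ≠ 0 := by positivity
  have h : π ^ (2 * n) = ((2 * n + 1)! : ℚ) • multipleZeta (List.replicate n 2) := by
    rw [multipleZeta_replicate_two, Rat.smul_def]
    push_cast
    field_simp
  rw [h]
  exact Submodule.smul_mem _ _ (multipleZeta_replicate_two_mem_hoffmanSpan n)

/-- The line `ℚ · π²ⁿ` lies in the Hoffman span of weight `2n`. [cite: Brown2012, §3.3 Lemma 3.4] -/
theorem span_pi_pow_le_hoffmanSpan (n : ℕ) :
    Submodule.span ℚ {π ^ (2 * n)} ≤ hoffmanSpan (2 * n) :=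
  Submodule.span_le.2 (Set.singleton_subset_iff.2 (pi_pow_two_mul_mem_hoffmanSpan n))

/-- **Euler's evaluation of `ζ(2k)`**, transported to `multipleZeta`:
`ζ(2k) = (-1)^{k+1} 2^{2k-1} π^{2k} B_{2k} / (2k)!` for `k ≥ 1` (Mathlib's `hasSum_zeta_nat` and
the depth-one bridge `multipleZeta [k] = ∑' n, 1/n^k`). [cite: ZagierECM1994, §9] -/
theorem multipleZeta_two_mul_eq {k : ℕ} (hk : k ≠ 0) :
    multipleZeta [2 * k] =
      (-1) ^ (k + 1) * 2 ^ (2 * k - 1) * π ^ (2 * k) * bernoulli (2 * k) / (2 * k)! := by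
  rw [multipleZeta_singleton_eq_zetaValue_of_ne_zero (by omega)]
  exact (hasSum_zeta_nat hk).tsum_eq

/-- **`ζ(2k) ∈ hoffmanSpan (2k)`** for every `k ≥ 1` — Brown's theorem `hoffmanSpan_eq_mzvSpace`
for the depth-one multiple zeta values of even weight, in all weights: `ζ(2k) ∈ ℚ π^{2k}` (Euler)
and `π^{2k} = (2k+1)! ζ({2}ᵏ)`. [cite: Brown2012, Theorem 1.1] -/
theorem multipleZeta_two_mul_mem_hoffmanSpan {k : ℕ} (hk : k ≠ 0) :
    multipleZeta [2 * k] ∈ hoffmanSpan (2 * k) := by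
  have h : multipleZeta [2 * k] =
      (((-1) ^ (k + 1) * 2 ^ (2 * k - 1) * bernoulli (2 * k) / (2 * k)! : ℚ) : ℝ) * π ^ (2 * k) := by
    rw [multipleZeta_two_mul_eq hk]
    push_cast
    ring
  rw [h, ← Rat.smul_def]
  exact Submodule.smul_mem _ _ (pi_pow_two_mul_mem_hoffmanSpan k)

/-- `ζ(n) ∈ hoffmanSpan n` for every even `n ≥ 2`. [cite: Brown2012, Theorem 1.1] -/
theorem multipleZeta_singleton_mem_hoffmanSpan_of_even {n : ℕ} (hn : Even n) (h0 : n ≠ 0) :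
    multipleZeta [n] ∈ hoffmanSpan n := by
  obtain ⟨k, rfl⟩ := hn
  rw [← two_mul] at h0 ⊢
  exact multipleZeta_two_mul_mem_hoffmanSpan (by omega)

/-- Products of even zeta values are in the Hoffman span: `ζ(2a) ζ(2b) ∈ hoffmanSpan (2a + 2b)`
(`a, b ≥ 1`). [cite: Brown2012, Theorem 1.1] -/
theorem multipleZeta_two_mul_mul_mem_hoffmanSpan {a b : ℕ} (ha : a ≠ 0) (hb : b ≠ 0) :
    multipleZeta [2 * a] * multipleZeta [2 * b] ∈ hoffmanSpan (2 * (a + b)) := by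
  set qa : ℚ := (-1) ^ (a + 1) * 2 ^ (2 * a - 1) * bernoulli (2 * a) / (2 * a)! with hqa
  set qb : ℚ := (-1) ^ (b + 1) * 2 ^ (2 * b - 1) * bernoulli (2 * b) / (2 * b)! with hqb
  have h : multipleZeta [2 * a] * multipleZeta [2 * b] = (qa * qb) • π ^ (2 * (a + b)) := by
    rw [multipleZeta_two_mul_eq ha, multipleZeta_two_mul_eq hb, Rat.smul_def, hqa, hqb]
    push_cast
    ring
  rw [h]
  exact Submodule.smul_mem _ _ (pi_pow_two_mul_mem_hoffmanSpan (a + b))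

/-- **Brown 2012, Lemma 3.4 (real shadow)**: `ζ({2}ⁿ)` is a positive rational multiple of `ζ(2)ⁿ`,
namely `ζ({2}ⁿ) = (6ⁿ/(2n+1)!) ζ(2)ⁿ`. [cite: Brown2012, §3.3 Lemma 3.4 and eq. (3.7)] -/
theorem multipleZeta_replicate_two_eq_mul_multipleZeta_two_pow (n : ℕ) :
    multipleZeta (List.replicate n 2) =
      ((6 ^ n / (2 * n + 1)! : ℚ) : ℝ) * multipleZeta [2] ^ n := by
  rw [multipleZeta_replicate_two, multipleZeta_two, div_pow, ← pow_mul, mul_comm 2 n]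
  have hf : ((2 * n + 1)! : ℝ) ≠ 0 := by positivity
  have h6 : (6 : ℝ) ^ n ≠ 0 := by positivity
  push_cast
  field_simp

end Literature.NumberTheory.Transcendental
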